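import Summits.AtomisticToContinuum.Crystallization.Theorems.FrustratedLawDichotomyDoublingGap

/-!
# FrustratedLawDichotomy · crux `AperiodicFrustratedLawGap` (stmt-AtomisticToContinuum-27623) — LINEAR IMAGES OF LAWS
# (decomp-a2c, prover hand 2, structural share, generation 2)

Transport of the frame «point-stationary probability law almost surely carried by rooted hard-core configurations» along a
measurable automorphism `e` of `ℝ³` COMPATIBLE WITH SUBTRACTION (`e (x - y) = e x - e y`: exactly the additive — in practice the linear —
automorphisms; dilations `z ↦ c • z` and the elements of `GL₃(ℝ)` are the two instances used downstream):

* `measurableEmbedding_mapConfig` — `μ ↦ e_*μ` is a measurable embedding of the Giry space (a measurable bijection with inverse `ν ↦ e⁻¹_*ν`),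
  so integrals against the image law `P ∘ (μ ↦ e_*μ)⁻¹` are computed by substitution WITHOUT measurability of the integrand and almost-sure
  properties transfer both ways;
* `map_count_restrict_eq` — `e_*(count|S) = count|(e S)`;
* `isRootedHardCore_mapConfig` — if `c · dist x y ≤ dist (e x) (e y)` (`c > 0`) then `e_*` maps rooted `δ`-hard-core configurations to rooted
  `c δ`-hard-core configurations;
* `isPointStationaryLaw_mapConfig` — MECKE TRANSFERS: `θ_{e y}(e_*μ) = e_*(θ_y μ)` and `-(e y) = e (-y)`, so the Mecke identity of the image law
  for `g` is the Mecke identity of `P` for `g'(μ, y) := g(e_*μ, e y)`;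
* `integral_rootEnergy_mapConfig` — `E_{P∘(e_*)⁻¹}[rootEnergy V] = E_P[½ ∫ V(‖e y‖) dμ]`;
* `eStar_le_integral_deformed` — granted the energy floor of item 9229 (hypothesis `hU`, Literature vocabulary; PROVED in the tree as
  `PalmUnimodularRigidity.UnimodularEnergyLowerBound`, whose olean is not importable on the farm at the time of writing), the `e`-deformed
  mean root energy of such a law is an admissible competitor: `e⋆ ≤ E_P[½ ∫ V_LJ(‖e y‖) dμ]`; instances `eStar_le_integral_linearDeformed`
  (`A ∈ GL₃(ℝ)`, hard core `δ/(‖A⁻¹‖+1)`) and `eStar_le_integral_dilated` (`z ↦ c • z`, hard core `c δ`).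

These are the inputs of the VIRIAL and AFFINE-STABILITY cuts of the crux (files `FrustratedLawDichotomyVirial`,
`FrustratedLawDichotomyAperiodicGapVirialCut`).  All `[folklore]` (cf. the unbuilt twin `ReggeStarCoercivity…AffineCompetitor` for `GL₃`).
-/

noncomputable section

namespace Summit.AtomisticToContinuum.Crystallization.Theorems.FrustratedLawDichotomyLinearImages

open MeasureTheory Metric Set Filter
open scoped ENNReal Topology BigOperators
open Literature.MathematicalPhysics.StatisticalMechanics Literature.Probability.Process
open Summit.AtomisticToContinuum.Crystallization.Theorems.ChargedEnergyGapNegative (E3 eStar)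
open Summit.AtomisticToContinuum.Crystallization.Theorems.BenjaminiSchrammLimit (measurableSet_setOf_isRootedHardCore)

/-! ## §1. Pushing configurations and laws forward along a subtraction-compatible measurable automorphism -/

section Push

variable (e : E3 ≃ᵐ E3)

/-- **`μ ↦ e_*μ` is a measurable embedding of the Giry space** (a measurable bijection, inverse `ν ↦ e⁻¹_*ν`). [folklore] -/
theorem measurableEmbedding_mapConfig : MeasurableEmbedding (fun μ : Measure E3 => μ.map e) :=
  (⟨⟨fun μ => μ.map e, fun ν => ν.map e.symm, fun _ => e.map_symm_map, fun _ => e.map_map_symm⟩,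
      Measure.measurable_map _ e.measurable, Measure.measurable_map _ e.symm.measurable⟩ :
    Measure E3 ≃ᵐ Measure E3).measurableEmbedding

/-- `e_*(count|S) = count|(e S)` for a measurable automorphism `e` of `ℝ³`. [folklore] -/
theorem map_count_restrict_eq (S : Set E3) :
    ((Measure.count : Measure E3).restrict S).map e = (Measure.count : Measure E3).restrict (e '' S) := by
  ext s hs
  rw [e.map_apply, Measure.restrict_apply hs, Measure.restrict_apply (e.measurable hs), ← image_preimage_inter e S s,
    Measure.count_injective_image e.injective]

/-- The image law of a probability law is a probability law. [folklore] -/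
theorem isProbabilityMeasure_mapConfig (P : Measure (Measure E3)) [IsProbabilityMeasure P] :
    IsProbabilityMeasure (P.map fun μ : Measure E3 => μ.map e) :=
  Measure.isProbabilityMeasure_map (measurableEmbedding_mapConfig e).measurable.aemeasurable

/-- **Mean root energy of the image law by substitution**: `E_{P∘(e_*)⁻¹}[rootEnergy V] = E_P[½ ∫ V(‖e y‖) dμ]` — no measurability or
integrability of the root energy is needed (`e_*` is a measurable bijection of the Giry space, `e` one of `ℝ³`). [folklore] -/
theorem integral_rootEnergy_mapConfig (V : ℝ → ℝ) (P : Measure (Measure E3)) :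
    ∫ ν, rootEnergy V ν ∂(P.map fun μ : Measure E3 => μ.map e) = ∫ μ, (∫ y, V ‖e y‖ ∂μ) / 2 ∂P := by
  rw [(measurableEmbedding_mapConfig e).integral_map]
  refine integral_congr_ae (Eventually.of_forall fun μ => ?_)
  simp only [rootEnergy_def, integral_map_equiv e]

variable {e}

/-- **Expanding automorphisms preserve hard cores**: if `c · dist x y ≤ dist (e x) (e y)` with `c > 0` and `e 0 = 0`, then the image of a
rooted `δ`-hard-core configuration is a rooted `c δ`-hard-core configuration. [folklore] -/
theorem isRootedHardCore_mapConfig (he0 : e 0 = 0) {c : ℝ} (hc : 0 < c) (hce : ∀ x y : E3, c * dist x y ≤ dist (e x) (e y))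
    {δ : ℝ} {μ : Measure E3} (h : IsRootedHardCore δ μ) : IsRootedHardCore (c * δ) (μ.map e) := by
  obtain ⟨S, h0, hsep, rfl⟩ := h
  refine ⟨e '' S, ⟨0, h0, he0⟩, ?_, map_count_restrict_eq e S⟩
  rintro _ ⟨x, hx, rfl⟩ _ ⟨y, hy, rfl⟩ hne
  have hxy : x ≠ y := fun hxy => hne (by rw [hxy])
  exact (mul_le_mul_of_nonneg_left (hsep x hx y hy hxy) hc.le).trans (hce x y)

/-- **Mecke transfers along subtraction-compatible automorphisms.**  If `e (x - y) = e x - e y` then re-rooting commutes with the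
push-forward, `θ_{e y}(e_*μ) = e_*(θ_y μ)`, and `-(e y) = e (-y)`; hence the image of a point-stationary law is point-stationary. [folklore] -/
theorem isPointStationaryLaw_mapConfig (he : ∀ x y : E3, e (x - y) = e x - e y) {P : Measure (Measure E3)}
    (hP : IsPointStationaryLaw P) : IsPointStationaryLaw (P.map fun μ : Measure E3 => μ.map e) := by
  have hΦ : MeasurableEmbedding (fun μ : Measure E3 => μ.map e) := measurableEmbedding_mapConfig e
  have hem : Measurable (e : E3 → E3) := e.measurable
  have he0 : e 0 = 0 := by have h := he 0 0; rwa [sub_self, sub_self] at h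
  have heneg : ∀ y : E3, e (-y) = -e y := fun y => by
    have h := he 0 y; rwa [zero_sub, he0, zero_sub] at h
  intro g hg
  rw [hΦ.lintegral_map, hΦ.lintegral_map]
  -- the transported test function
  have hg' : Measurable (Function.uncurry fun (μ : Measure E3) (y : E3) => g (μ.map e) (e y)) :=
    hg.comp ((hΦ.measurable.comp measurable_fst).prodMk (hem.comp measurable_snd))
  -- re-rooting commutes with the push-forward
  have hkey : ∀ (μ : Measure E3) (y : E3), (μ.map fun z => z - y).map e = (μ.map e).map fun z => z - e y := by
    intro μ y
    rw [Measure.map_map hem (measurable_sub_const y), Measure.map_map (measurable_sub_const (e y)) hem]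
    congr 1
    funext z
    simp only [Function.comp_apply, he]
  calc ∫⁻ μ, ∫⁻ y, g (μ.map e) y ∂(μ.map e) ∂P
      = ∫⁻ μ, ∫⁻ y, g (μ.map e) (e y) ∂μ ∂P :=
        lintegral_congr fun μ : Measure E3 => lintegral_map_equiv (fun y => g (μ.map e) y) e
    _ = ∫⁻ μ, ∫⁻ y, g ((μ.map fun z => z - y).map e) (e (-y)) ∂μ ∂P := hP _ hg'
    _ = ∫⁻ μ, ∫⁻ y, g ((μ.map e).map fun z => z - e y) (-e y) ∂μ ∂P := by simp only [hkey, heneg]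
    _ = ∫⁻ μ, ∫⁻ y, g ((μ.map e).map fun z => z - y) (-y) ∂(μ.map e) ∂P :=
        (lintegral_congr fun μ : Measure E3 => lintegral_map_equiv (fun y => g ((μ.map e).map fun z => z - y) (-y)) e).symm

/-- Almost-sure hard core of the image law. [folklore] -/
theorem ae_isRootedHardCore_mapConfig (he0 : e 0 = 0) {c : ℝ} (hc : 0 < c) (hce : ∀ x y : E3, c * dist x y ≤ dist (e x) (e y))
    {δ : ℝ} {P : Measure (Measure E3)} (hcore : ∀ᵐ μ ∂P, IsRootedHardCore δ μ) :
    ∀ᵐ ν ∂(P.map fun μ : Measure E3 => μ.map e), IsRootedHardCore (c * δ) ν :=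
  (measurableEmbedding_mapConfig e).ae_map_iff.2 (hcore.mono fun _ hμ => isRootedHardCore_mapConfig he0 hc hce hμ)

end Push

/-! ## §2. Deformed mean energies are admissible competitors (granted the floor of item 9229) -/

section Floor

variable {δ : ℝ} {P : Measure (Measure E3)}

/-- **The deformed mean root energy is an admissible competitor.**  Granted the energy floor for point-stationary hard-core probability laws
(item 9229, hypothesis `hU`), for every subtraction-compatible measurable automorphism `e` of `ℝ³` expanding distances by at least a factor
`c > 0`: `e⋆ ≤ E_P[½ ∫ V_LJ(‖e y‖) dμ]` — the image law is a point-stationary `c δ`-hard-core probability law with exactly this mean root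
energy. [folklore] -/
theorem eStar_le_integral_deformed
    (hU : ∀ δ' : ℝ, 0 < δ' → ∀ Q : Measure (Measure E3), IsProbabilityMeasure Q → (∀ᵐ μ ∂Q, IsRootedHardCore δ' μ) →
      IsPointStationaryLaw Q → eStar ≤ ∫ μ, rootEnergy lennardJones μ ∂Q)
    (hδ : 0 < δ) [IsProbabilityMeasure P] (hcore : ∀ᵐ μ ∂P, IsRootedHardCore δ μ) (hstat : IsPointStationaryLaw P)
    {e : E3 ≃ᵐ E3} (he : ∀ x y : E3, e (x - y) = e x - e y) {c : ℝ} (hc : 0 < c)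
    (hce : ∀ x y : E3, c * dist x y ≤ dist (e x) (e y)) :
    eStar ≤ ∫ μ, (∫ y, lennardJones ‖e y‖ ∂μ) / 2 ∂P := by
  have he0 : e 0 = 0 := by have h := he 0 0; rwa [sub_self, sub_self] at h
  haveI := isProbabilityMeasure_mapConfig e P
  have h := hU (c * δ) (mul_pos hc hδ) _ (isProbabilityMeasure_mapConfig e P) (ae_isRootedHardCore_mapConfig he0 hc hce hcore)
    (isPointStationaryLaw_mapConfig he hstat)
  rwa [integral_rootEnergy_mapConfig] at h

/-- **Linear deformations** (`A ∈ GL₃(ℝ)`): granted the floor, `e⋆ ≤ E_P[½ ∫ V_LJ(‖A y‖) dμ]` for every point-stationary `δ`-hard-core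
probability law `P` (`‖x‖ ≤ ‖A⁻¹‖ ‖A x‖` gives the expansion constant `(‖A⁻¹‖ + 1)⁻¹`). [folklore] -/
theorem eStar_le_integral_linearDeformed
    (hU : ∀ δ' : ℝ, 0 < δ' → ∀ Q : Measure (Measure E3), IsProbabilityMeasure Q → (∀ᵐ μ ∂Q, IsRootedHardCore δ' μ) →
      IsPointStationaryLaw Q → eStar ≤ ∫ μ, rootEnergy lennardJones μ ∂Q)
    (hδ : 0 < δ) [IsProbabilityMeasure P] (hcore : ∀ᵐ μ ∂P, IsRootedHardCore δ μ) (hstat : IsPointStationaryLaw P)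
    (A : E3 ≃L[ℝ] E3) : eStar ≤ ∫ μ, (∫ y, lennardJones ‖A y‖ ∂μ) / 2 ∂P := by
  set e : E3 ≃ᵐ E3 := A.toHomeomorph.toMeasurableEquiv with he_def
  have hecoe : ∀ x : E3, e x = A x := fun x => rfl
  have he : ∀ x y : E3, e (x - y) = e x - e y := fun x y => by simp only [hecoe, map_sub]
  set K : ℝ := ‖(A.symm : E3 →L[ℝ] E3)‖ with hK_def
  have hK : 0 ≤ K := norm_nonneg _
  have hce : ∀ x y : E3, (K + 1)⁻¹ * dist x y ≤ dist (e x) (e y) := by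
    intro x y
    rw [hecoe, hecoe, dist_eq_norm, dist_eq_norm, ← map_sub]
    have h1 : ‖x - y‖ ≤ K * ‖A (x - y)‖ := by
      calc ‖x - y‖ = ‖(A.symm : E3 →L[ℝ] E3) (A (x - y))‖ := by simp
        _ ≤ K * ‖A (x - y)‖ := ContinuousLinearMap.le_opNorm _ _
    rw [inv_mul_le_iff₀ (by positivity)]
    nlinarith [norm_nonneg (A (x - y))]
  have h := eStar_le_integral_deformed hU hδ hcore hstat he (by positivity : (0 : ℝ) < (K + 1)⁻¹) hce
  simpa only [hecoe] using h

/-- **Dilations** (`z ↦ c • z`, `c > 0`): granted the floor, `e⋆ ≤ E_P[½ ∫ V_LJ(c ‖y‖) dμ]` for every point-stationary `δ`-hard-core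
probability law `P` (the dilated law is a point-stationary `c δ`-hard-core probability law). [folklore] -/
theorem eStar_le_integral_dilated
    (hU : ∀ δ' : ℝ, 0 < δ' → ∀ Q : Measure (Measure E3), IsProbabilityMeasure Q → (∀ᵐ μ ∂Q, IsRootedHardCore δ' μ) →
      IsPointStationaryLaw Q → eStar ≤ ∫ μ, rootEnergy lennardJones μ ∂Q)
    (hδ : 0 < δ) [IsProbabilityMeasure P] (hcore : ∀ᵐ μ ∂P, IsRootedHardCore δ μ) (hstat : IsPointStationaryLaw P)
    {c : ℝ} (hc : 0 < c) : eStar ≤ ∫ μ, (∫ y, lennardJones (c * ‖y‖) ∂μ) / 2 ∂P := by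
  set e : E3 ≃ᵐ E3 := (Homeomorph.smulOfNeZero c hc.ne').toMeasurableEquiv with he_def
  have hecoe : ∀ x : E3, e x = c • x := fun x => rfl
  have he : ∀ x y : E3, e (x - y) = e x - e y := fun x y => by simp only [hecoe, smul_sub]
  have hce : ∀ x y : E3, c * dist x y ≤ dist (e x) (e y) := fun x y => by
    rw [hecoe, hecoe, dist_smul₀, Real.norm_of_nonneg hc.le]
  have h := eStar_le_integral_deformed hU hδ hcore hstat he hc hce
  have hnorm : ∀ y : E3, ‖e y‖ = c * ‖y‖ := fun y => by rw [hecoe, norm_smul, Real.norm_of_nonneg hc.le]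
  simpa only [hnorm] using h

end Floor

end Summit.AtomisticToContinuum.Crystallization.Theorems.FrustratedLawDichotomyLinearImages

end
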